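import Summits.BirchSwinnertonDyer.BirchSwinnertonDyer.Theorems.SignedLowerHalvesSprungLowerHalfAtThreeSplitInputs
import Summits.BirchSwinnertonDyer.BirchSwinnertonDyer.Theorems.PrintX8VSInputHondaSystem
import HarnessLib

/-!
# S4 `SharpFlatPublishedInputsAtThree` (stmt-BirchSwinnertonDyer-19929) with its conjunct (H) = Sprung 2012 Thm. 2.2 DISCHARGED

LADDER-BSD D-0154 (2) INPUTS→UNCONDITIONAL, INPUTS-LIST-2 row F13, ADDENDUM-7 §C tranche **T10** (desk bsd-inputs-plan-2; filed by
seat bsd-inputs-honda-p1, the author of the `SprungHonda` series p610480 … p618507). Item 19929 (support r504; child 4/4 of the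
split of crux `SprungLowerHalfAtThree`, binder `hB3` of the SignedLowerHalves `closes`) is `(M) newform ∧ (H) Sprung 2012 Thm 2.2
at p = 3 ∧ (T) Sprung 2012 Thm 1.2/7.14 on ClassX8`; its landed door
`SprungLowerHalfAtThreeSplit.sharpFlatPublishedInputsAtThree_of_namedFacts (hmod) (h22) (h714)` takes (H) as a hypothesis. Since
p618507 the named fact `Sprung2012.thm22_exists_isHondaSystem` is the THEOREM
`Summit.BirchSwinnertonDyer.BirchSwinnertonDyer.Theorems.thm22_exists_isHondaSystem_holds` (`Theorems/PrintX8VSInputHondaSystem.lean`).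
This file specialises the three doors at `h22 := thm22_exists_isHondaSystem_holds`: 19929 ⟸ {modularity `exists_isNewformOf`,
Sprung 2012 Thm 1.2/7.14} — two cites, no third; given the deciding theorem's binder `PublishedSignedInputs` (19005), child 19929
costs the route exactly ONE further print (Thm 1.2/7.14).

IMPORT NOTE (gate ruling at dry-run, 2026-08-28): the desk's sketches carried a LOCAL COPY of the six-line proof so that this file's
import closure would avoid `Theses.PrintX8VS` / `Theses.PrintX8` (imported by `PrintX8VSInputHondaSystem.lean`, which closes their item
`InputHondaSystem`); the gate refuses any copy (`dedup.landed`: "import the landed module and reuse"), so the landed module is imported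
and the two x8 route files enter this file's closure as REBUILD COUPLING ONLY — no declaration of either route is used here.

HONEST FRAMING: theorems only (no definition, no named fact, no `sorry`); CONDITIONAL doors — item 19929 is NOT closed (its (M) and
(T) conjuncts stay HELD inputs); crux 19003 and the other split children are untouched; proving the input (H) makes these doors
unconditional in (H) AS TYPED only; BSD is not proved by any of this. `--supports stmt-BirchSwinnertonDyer-19929`.

References: [Sprung2012] F. Sprung, J. Number Theory 132 (2012), Thm. 2.2 (p. 1487), Thm. 1.2 (p. 1486) / Thm. 7.14 (p. 1504);
[BCDTJAMS2001] Breuil–Conrad–Diamond–Taylor, J. Amer. Math. Soc. 14 (2001), Thm. A; [Kobayashi2003] Invent. Math. 152 (2003), §8.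
-/

set_option autoImplicit false
-- the Theorems namespace of this sub repeats the summit name by design (D-0017 nested layout)
set_option linter.dupNamespace false

noncomputable section

/-! ## The doors of item 19929 with (H) discharged by `Theorems.thm22_exists_isHondaSystem_holds` -/

namespace Summit.BirchSwinnertonDyer.BirchSwinnertonDyer.Theorems.SprungLowerHalfAtThreeSplit

open Literature.NumberTheory.EllipticCurves Literature.NumberTheory.EllipticCurves.ModularForms
  Literature.NumberTheory.EllipticCurves.Sprung2012
  Summit.BirchSwinnertonDyer.BirchSwinnertonDyer.Theses.SignedLowerHalves

/-- **S4 from modularity and Sprung 2012 Thm 1.2/7.14 alone** — conjunct (H) (Sprung 2012 Thm 2.2 at `p = 3`) is the theorem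
`Theorems.thm22_exists_isHondaSystem_holds` (p618507). CONDITIONAL on the two displayed facts; closes nothing.
[cite: BCDTJAMS2001, Thm. A] [cite: Sprung2012, Thm. 2.2 (p. 1487) and Thm. 1.2 (p. 1486)] -/
theorem sharpFlatPublishedInputsAtThree_of_modularity_of_thm714
    (hmod : exists_isNewformOf) (h714 : thm714_sharpFlatSelmerDual_finite_torsion) :
    Summit.BirchSwinnertonDyer.BirchSwinnertonDyer.Theses.SignedLowerHalves.SharpFlatPublishedInputsAtThree :=
  sharpFlatPublishedInputsAtThree_of_namedFacts hmod thm22_exists_isHondaSystem_holds h714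

/-- **S4 from the route's HELD modularity support `ModularParametrizationSupply`** (stmt-BirchSwinnertonDyer-19266) **and Sprung 2012
Thm 1.2/7.14** — (H) discharged. CONDITIONAL; closes nothing. [cite: BCDTJAMS2001, Thm. A] [cite: Sprung2012, Thm. 1.2 (p. 1486)] -/
theorem sharpFlatPublishedInputsAtThree_of_modularParametrizationSupply_of_thm714
    (hmodP : Summit.BirchSwinnertonDyer.BirchSwinnertonDyer.Theses.SignedLowerHalves.ModularParametrizationSupply)
    (h714 : thm714_sharpFlatSelmerDual_finite_torsion) :
    Summit.BirchSwinnertonDyer.BirchSwinnertonDyer.Theses.SignedLowerHalves.SharpFlatPublishedInputsAtThree :=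
  sharpFlatPublishedInputsAtThree_of_modularParametrizationSupply hmodP thm22_exists_isHondaSystem_holds h714

/-- **S4 from the deciding theorem's binder `PublishedSignedInputs`** (stmt-BirchSwinnertonDyer-19005, eighth conjunct) **and Sprung 2012
Thm 1.2/7.14** — (H) discharged: given `hPub`, child 19929 costs the route exactly ONE further print (Thm 1.2/7.14). CONDITIONAL; closes
nothing. [cite: BCDTJAMS2001, Thm. A] [cite: Sprung2012, Thm. 1.2 (p. 1486)] -/
theorem sharpFlatPublishedInputsAtThree_of_publishedSignedInputs_of_thm714
    (hPub : Summit.BirchSwinnertonDyer.BirchSwinnertonDyer.Theses.SignedLowerHalves.PublishedSignedInputs)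
    (h714 : thm714_sharpFlatSelmerDual_finite_torsion) :
    Summit.BirchSwinnertonDyer.BirchSwinnertonDyer.Theses.SignedLowerHalves.SharpFlatPublishedInputsAtThree :=
  sharpFlatPublishedInputsAtThree_of_publishedSignedInputs hPub thm22_exists_isHondaSystem_holds h714

end Summit.BirchSwinnertonDyer.BirchSwinnertonDyer.Theorems.SprungLowerHalfAtThreeSplit

end
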